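import Literature.AnabelianGeometry.AbsoluteAnabelian.AbsTopII.InertiaGroups

/-!
# [AbsTopII] Prop 1.3 (viii), (x) with the PRINTED conjugacy scope (v2 of the typings in `InertiaGroups.lean`)

S. Mochizuki, *Topics in Absolute Anabelian Geometry II* [AbsTopII] (bib `MochizukiAbsTopII2013`;
locators = PDF pages of the kurims manuscript `paper:url-585b8d0ad0d9`), §1, Def 1.2 (ii) p. 10,
Prop 1.3 (viii), (x) p. 12.

Statement file (2 predicates), abc-iut-L4-t6 lineage (typer of record of
Prop 1.3 (i)(ii)(viii)(x), `AbsTopII/InertiaGroups.lean` p405221), repairing FINDING F-L4t6g5-1: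
Def 1.2 (ii) determines `Π_e`, `D_e`, `I_v` "up to conjugation in `Π_𝔾`", whereas the v1 predicates
`DPSCIndexData.Prop_1_3_viii` / `Prop_1_3_x` quantify the conjugating element over all of `Π_H` —
too strong when the outer action of `H` moves edges (kernel certificates
`AbsTopII/Prop13ConjugacyScope.lean`, p425481).  The primed predicates below carry the printed
`Π_𝔾`-scope; the sibling repair of abc-iut-L4-t4's `DPSCData.Prop13iv` is `DPSCData.Prop13iv'`
(`AbsTopII/DecompositionGroups.lean` v2, p425881).  Typed ≠ proved (these are predicates on abstract
DPSC data, asserted for data arising from a stable log curve); nothing here bears on [IUTchIII]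
Cor 3.12.
-/

open scoped Pointwise

universe u

namespace Literature.AnabelianGeometry.AbsoluteAnabelian.AbsTopII

namespace DPSCIndexData

variable (X : DPSCIndexData.{u})

/-! ### The printed conjugacy scope: `Π_𝔾`-conjugates

Def 1.2 (ii) p. 10 determines `Π_e`, `D_e`, `I_v` "up to conjugation in `Π_𝔾`".  The v1 predicates
`Prop_1_3_viii` and `Prop_1_3_x` of `AbsTopII/InertiaGroups.lean` (p405221) quantify the
conjugating element over all of `Π_H`; when the outer action of `H` on `𝔾` moves edges this is STRONGER than print and fails (kernel certificates:
`AbsTopII/Prop13ConjugacyScope.lean`, `not_prop_1_3_viii_of_nodeSub_moved`,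
`not_prop_1_3_x_of_cusps_moved`).  The primed predicates below restate (viii) and (x) with
`Π_𝔾`-conjugates (`γ ∈ Π_𝔾`), exactly as printed; they supersede the v1 forms for consumers (the v1
declarations stay in `InertiaGroups.lean`, referenced by the DAG index). -/

/-- **Prop 1.3 (viii)** p. 12, PRINTED CONJUGACY SCOPE (v2): "Let `e, e'` be edges of `𝔾`. If
`D_e ∩ D_{e'} ∩ Π_I ≠ {1}`, then one of the following two [mutually exclusive] properties holds:
(1) `e = e'`; (2) `e` and `e'` are distinct, but abut to the same vertex `v`, and
`D_e ∩ D_{e'} ∩ Π_𝔾 = {1}`. Moreover, in the situation of (2), [for appropriate choices of conjugates]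
we have `I_v = D_e ∩ D_{e'} ∩ Π_I`" — `D_{e'}` ranging over its `Π_𝔾`-conjugates `γ·D_{e'}·γ⁻¹`,
`γ ∈ Π_𝔾`, and the appropriate conjugate of `I_v` a `Π_𝔾`-conjugate (Def 1.2 (ii) p. 10: "up to
conjugation in `Π_𝔾`"). Supersedes `Prop_1_3_viii`. [cite: MochizukiAbsTopII2013, Prop 1.3 (viii) p.12] -/
def Prop_1_3_viii' : Prop :=
  ∀ (e e' : X.Edge) (γ : X.PiH), γ ∈ X.PiG →
    X.DEdge e ⊓ MulAut.conj γ • X.DEdge e' ⊓ X.PiI ≠ ⊥ →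
    e = e' ∨
      (e ≠ e' ∧ ∃ v : X.Vert, X.EdgeAbuts e v ∧ X.EdgeAbuts e' v ∧
        X.DEdge e ⊓ MulAut.conj γ • X.DEdge e' ⊓ X.PiG = ⊥ ∧
        ∃ h : X.PiH, h ∈ X.PiG ∧
          MulAut.conj h • X.Iv v = X.DEdge e ⊓ MulAut.conj γ • X.DEdge e' ⊓ X.PiI)

/-- **Prop 1.3 (x)** p. 12, PRINTED CONJUGACY SCOPE (v2): as `Prop_1_3_x`, with "[for an appropriate
choice of conjugate of `D_{e_τ}`]", "[and an appropriate choice of conjugate of `I_{v_τ}`]", "[… of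
`I_{e_τ}`]" read as `Π_𝔾`-conjugates (`γ ∈ Π_𝔾`; Def 1.2 (ii) p. 10) — "if `τ_I` is non-verticial
and non-edge-like, then the image of `τ_S` is the unique cusp `e_τ` of `X` such that
`τ_I(I) ⊆ D_{e_τ}` …; `τ_I(I) = I_{v_τ}` … if and only if the image of `τ_S` is a non-nodal point of
the irreducible component … corresponding to `v_τ`; `τ_I` is non-verticial and … `τ_I(I) ⊆ I_{e_τ}` …
if and only if the image of `τ_S` is the node … corresponding to `e_τ`". Supersedes `Prop_1_3_x`.
[cite: MochizukiAbsTopII2013, Prop 1.3 (x) p.12] -/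
def Prop_1_3_x' : Prop :=
  ∀ τ : X.LogPointData,
    (τ.IsNonVerticial → τ.IsNonEdgeLike →
      ∃ e : X.Cusp, τ.kind = PointKind.cusp e ∧
        ∀ e' : X.Cusp,
          (∃ γ : X.PiH, γ ∈ X.PiG ∧ τ.image ≤ MulAut.conj γ • X.DvCusp e') ↔ e' = e) ∧
    ((∀ e : X.Cusp, τ.kind ≠ PointKind.cusp e) →
      (∀ v : X.Vert,
        (∃ γ : X.PiH, γ ∈ X.PiG ∧ τ.image = MulAut.conj γ • X.Iv v) ↔ τ.kind = PointKind.smooth v) ∧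
      (∀ e : X.Node,
        (τ.IsNonVerticial ∧ ∃ γ : X.PiH, γ ∈ X.PiG ∧ τ.image ≤ MulAut.conj γ • X.IvNode e) ↔
          τ.kind = PointKind.node e))

end DPSCIndexData

end Literature.AnabelianGeometry.AbsoluteAnabelian.AbsTopII
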